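import Summits.Ventures.Crystal3D.Theorems.StickyWulffConstantGenericWallFloorRunTops
import HarnessLib

/-!
# The two-thirds lemma: run tops of a shifted-away predicate (composition layers of a co-axial twin pair)

HONEST FRAMING. Part of the venture `Summits/Ventures/Crystal3D` (cell `crystal3d-full`), helper
`--supports` the crux `CoaxialWallLaw` (stmt-Ventures-19481, `route-Ventures-StickyWulffConstant`),
REGISTERED line `WallLedgerF` (planner cf-p1 gen 16), open stub `stub_coaxialTwoSlabAdhesion`.
Pure finite combinatorics in a real vector space (companion of `…GenericWallFloorRunTops`); rung credit
only, F-C1 not moved.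

WHY.  In the two-slab cell of a co-axial TWIN pair the in-plane slot lines of grain 1 that lie in a
COMPOSITION layer (a layer of `Λ₁ ∩ Λ₂`) run straight into the complete top sample and need not end in
the payer window; the layered rung (`…CoaxialWallLawInPlaneRunEnds`, `…CoaxialWallLawLayered`) must show
that at least TWO THIRDS of the rooted lines are off `Λ₂`.  Composition layers are one residue class of
layers mod 3, i.e. of three consecutive layers at most one is a composition layer; this file turns that
into a count of run tops:

* `pred_add_nsmul_iff` — a predicate constant along `d`-steps is constant along `d`-runs;
* `two_mul_card_tops_le_three_mul` — THE TWO-THIRDS LEMMA: a run-convex sample `P''` (along `d ≠ 0`),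
  a sample `P'` with `P'' + εg ⊆ P'` for `ε ∈ {−1, 0, 1}`, a predicate `N` constant along `d` such that for
  every `p ∈ P''` at least two of `p − g, p, p + g` satisfy `N`; then
  `2 · #tops(P'', d) ≤ 3 · #{tops of P' satisfying N}`.  Proof: send the pair `(p, ε)` (with
  `N (p + εg)`) to the `P'`-run top of `p + εg`; it is an `N`-top of `P'`; for FIXED `ε` the map is
  injective (two tops of the run-convex `P''` on one `d`-line coincide), so its fibres have at most three
  elements, while every top `p` of `P''` carries at least two admissible `ε`.

WHAT THIS IS NOT: no geometry, no packing; F-C1 not moved.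
-/

noncomputable section

namespace Summit.Ventures.Crystal3D.Theorems

open Finset

/-! ## The two-thirds lemma -/

section TwoThirds

variable {E : Type*} [NormedAddCommGroup E] [NormedSpace ℝ E]

/-- A predicate constant along `d`-steps is constant along `d`-runs. -/
theorem pred_add_nsmul_iff {N : E → Prop} {d : E} (hN : ∀ q, N q ↔ N (q + d)) (x : E) (m : ℕ) :
    N (x + ((m : ℕ) : ℝ) • d) ↔ N x := by
  induction m with
  | zero => rw [Nat.cast_zero, zero_smul, add_zero]
  | succ m ih =>
    have e : x + ((m + 1 : ℕ) : ℝ) • d = (x + ((m : ℕ) : ℝ) • d) + d := by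
      push_cast; rw [add_smul, one_smul, add_assoc]
    rw [e, ← hN, ih]

open scoped Classical in
/-- **The two-thirds lemma.**  See the module docstring. -/
theorem two_mul_card_tops_le_three_mul (P' P'' : Finset E) (d g : E) (hd : d ≠ 0) (N : E → Prop)
    (hshift : ∀ p ∈ P'', ∀ ε ∈ ({-1, 0, 1} : Finset ℝ), p + ε • g ∈ P')
    (hconv'' : ∀ p ∈ P'', ∀ D : ℕ, p + ((D : ℕ) : ℝ) • d ∈ P'' → ∀ k : ℕ, k ≤ D → p + ((k : ℕ) : ℝ) • d ∈ P'')
    (hN : ∀ q, N q ↔ N (q + d))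
    (htwo : ∀ p ∈ P'', ∃ ε₁ ∈ ({-1, 0, 1} : Finset ℝ), ∃ ε₂ ∈ ({-1, 0, 1} : Finset ℝ),
      ε₁ ≠ ε₂ ∧ N (p + ε₁ • g) ∧ N (p + ε₂ • g)) :
    2 * (P''.filter fun p => p + d ∉ P'').card ≤
      3 * ((P'.filter fun p => p + d ∉ P').filter fun p => N p).card := by
  -- the run-top map of `P'`
  have key : ∀ x ∈ P', ∃ m : ℕ, x + ((m : ℕ) : ℝ) • d ∈ P' ∧ x + ((m + 1 : ℕ) : ℝ) • d ∉ P' ∧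
      ∀ k : ℕ, k ≤ m → x + ((k : ℕ) : ℝ) • d ∈ P' := fun x hx => exists_runTop P' x d hd hx
  choose! m hm using key
  set T'' := P''.filter fun p => p + d ∉ P'' with hT''
  set T'N := (P'.filter fun p => p + d ∉ P').filter fun p => N p with hT'N
  set S : Finset (E × ℝ) := (T'' ×ˢ ({-1, 0, 1} : Finset ℝ)).filter fun pe => N (pe.1 + pe.2 • g)
    with hS
  set Φ : E × ℝ → E := fun pe => (pe.1 + pe.2 • g) + ((m (pe.1 + pe.2 • g) : ℕ) : ℝ) • d with hΦ
  -- (1) `Φ` maps `S` into the `N`-tops of `P'`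
  have hΦmem : ∀ pe ∈ S, Φ pe ∈ T'N := by
    intro pe hpe
    rw [hS, mem_filter, mem_product] at hpe
    obtain ⟨⟨hp, hε⟩, hNx⟩ := hpe
    have hpP'' : pe.1 ∈ P'' := (mem_filter.1 hp).1
    have hx : pe.1 + pe.2 • g ∈ P' := hshift pe.1 hpP'' pe.2 hε
    obtain ⟨hxm, hxm1, -⟩ := hm _ hx
    rw [hT'N, mem_filter, mem_filter]
    refine ⟨⟨hxm, ?_⟩, (pred_add_nsmul_iff hN _ _).2 hNx⟩
    have e : pe.1 + pe.2 • g + ((m (pe.1 + pe.2 • g) : ℕ) : ℝ) • d + d =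
        pe.1 + pe.2 • g + ((m (pe.1 + pe.2 • g) + 1 : ℕ) : ℝ) • d := by
      push_cast; rw [add_smul, one_smul, add_assoc]
    show pe.1 + pe.2 • g + ((m (pe.1 + pe.2 • g) : ℕ) : ℝ) • d + d ∉ P'
    rw [e]; exact hxm1
  -- (2) for a fixed shift `ε` the map is injective on tops of `P''`
  have hinj : ∀ p ∈ T'', ∀ p' ∈ T'', ∀ ε ∈ ({-1, 0, 1} : Finset ℝ),
      Φ (p, ε) = Φ (p', ε) → p = p' := by
    intro p hp p' hp' ε hε hEq
    have hpP'' : p ∈ P'' := (mem_filter.1 hp).1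
    have hp'P'' : p' ∈ P'' := (mem_filter.1 hp').1
    have hptop : p + d ∉ P'' := (mem_filter.1 hp).2
    have hp'top : p' + d ∉ P'' := (mem_filter.1 hp').2
    simp only [hΦ] at hEq
    set a : ℕ := m (p + ε • g) with ha
    set b : ℕ := m (p' + ε • g) with hb
    have hEq' : p + ((a : ℕ) : ℝ) • d = p' + ((b : ℕ) : ℝ) • d := by
      rw [add_right_comm p (ε • g), add_right_comm p' (ε • g)] at hEq
      exact add_right_cancel hEq
    by_contra hne
    rcases lt_trichotomy a b with hlt | heq | hgt
    · have hdiff : p = p' + (((b - a : ℕ) : ℕ) : ℝ) • d := by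
        have h1 : ((b : ℕ) : ℝ) = ((b - a : ℕ) : ℝ) + ((a : ℕ) : ℝ) := by
          push_cast [Nat.cast_sub hlt.le]; ring
        have h2 : p' + ((b : ℕ) : ℝ) • d = (p' + ((b - a : ℕ) : ℝ) • d) + ((a : ℕ) : ℝ) • d := by
          rw [h1, add_smul, add_assoc]
        rw [h2] at hEq'
        exact add_right_cancel hEq'
      have hmem : p' + (((b - a : ℕ) : ℕ) : ℝ) • d ∈ P'' := by rw [← hdiff]; exact hpP''
      have := hconv'' p' hp'P'' (b - a) hmem 1 (by omega)
      simp at this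
      exact hp'top this
    · apply hne
      rw [heq] at hEq'
      exact add_right_cancel hEq'
    · have hdiff : p' = p + (((a - b : ℕ) : ℕ) : ℝ) • d := by
        have h1 : ((a : ℕ) : ℝ) = ((a - b : ℕ) : ℝ) + ((b : ℕ) : ℝ) := by
          push_cast [Nat.cast_sub hgt.le]; ring
        have h2 : p + ((a : ℕ) : ℝ) • d = (p + ((a - b : ℕ) : ℝ) • d) + ((b : ℕ) : ℝ) • d := by
          rw [h1, add_smul, add_assoc]
        rw [h2] at hEq'
        exact (add_right_cancel hEq').symm
      have hmem : p + (((a - b : ℕ) : ℕ) : ℝ) • d ∈ P'' := by rw [← hdiff]; exact hp'P''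
      have := hconv'' p hpP'' (a - b) hmem 1 (by omega)
      simp at this
      exact hptop this
  -- (3) fibres of `Φ` on `S` have at most three elements
  have hfib : ∀ t ∈ S.image Φ, (S.filter fun pe => Φ pe = t).card ≤ 3 := by
    intro t _
    have h3 : (({-1, 0, 1} : Finset ℝ)).card ≤ 3 := by
      refine (card_insert_le _ _).trans (Nat.succ_le_succ ?_)
      refine (card_insert_le _ _).trans (Nat.succ_le_succ ?_)
      rw [card_singleton]
    refine le_trans ?_ h3
    refine card_le_card_of_injOn Prod.snd ?_ ?_
    · intro pe hpe
      rw [mem_coe, mem_filter, hS, mem_filter, mem_product] at hpe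
      exact hpe.1.1.2
    · intro pe hpe pe' hpe' hsnd
      rw [mem_coe, mem_filter] at hpe hpe'
      have h1 := hpe.1; have h1' := hpe'.1
      rw [hS, mem_filter, mem_product] at h1 h1'
      have hε : pe.2 = pe'.2 := hsnd
      have hΦeq : Φ (pe.1, pe.2) = Φ (pe'.1, pe.2) := by
        calc Φ (pe.1, pe.2) = Φ pe := rfl
          _ = Φ pe' := hpe.2.trans hpe'.2.symm
          _ = Φ (pe'.1, pe'.2) := rfl
          _ = Φ (pe'.1, pe.2) := by rw [hε]
      have hfst := hinj pe.1 h1.1.1 pe'.1 h1'.1.1 pe.2 h1.1.2 hΦeq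
      exact Prod.ext hfst hε
  have hS3 : S.card ≤ 3 * (S.image Φ).card := card_le_mul_card_image S 3 hfib
  -- (4) every top of `P''` contributes at least two pairs
  have hS2 : 2 * T''.card ≤ S.card := by
    have hsub : T'' ⊆ S.image Prod.fst := by
      intro p hp
      obtain ⟨ε₁, hε₁, ε₂, hε₂, -, hN₁, -⟩ := htwo p (mem_filter.1 hp).1
      exact mem_image.2 ⟨(p, ε₁), by rw [hS, mem_filter, mem_product]; exact ⟨⟨hp, hε₁⟩, hN₁⟩, rfl⟩
    have hfib2 : ∀ p ∈ S.image Prod.fst, 2 ≤ (S.filter fun pe => pe.1 = p).card := by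
      intro p hp
      obtain ⟨pe, hpe, rfl⟩ := mem_image.1 hp
      have hpT : pe.1 ∈ T'' := by
        rw [hS, mem_filter, mem_product] at hpe; exact hpe.1.1
      obtain ⟨ε₁, hε₁, ε₂, hε₂, hne, hN₁, hN₂⟩ := htwo pe.1 (mem_filter.1 hpT).1
      have hsub2 : ({(pe.1, ε₁), (pe.1, ε₂)} : Finset (E × ℝ)) ⊆ S.filter fun qe => qe.1 = pe.1 := by
        intro qe hqe
        rw [mem_insert, mem_singleton] at hqe
        rw [mem_filter, hS, mem_filter, mem_product]
        rcases hqe with rfl | rfl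
        · exact ⟨⟨⟨hpT, hε₁⟩, hN₁⟩, rfl⟩
        · exact ⟨⟨⟨hpT, hε₂⟩, hN₂⟩, rfl⟩
      have hcard2 : ({(pe.1, ε₁), (pe.1, ε₂)} : Finset (E × ℝ)).card = 2 := by
        rw [card_insert_of_notMem, card_singleton]
        rw [mem_singleton]
        intro h; exact hne (congrArg Prod.snd h)
      have := card_le_card hsub2
      omega
    have h := mul_card_image_le_card S 2 hfib2
    have := card_le_card hsub
    calc 2 * T''.card ≤ 2 * (S.image Prod.fst).card := Nat.mul_le_mul_left 2 this
      _ ≤ S.card := h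
  -- (5) the image lies in the `N`-tops
  have himg : (S.image Φ).card ≤ T'N.card :=
    card_le_card (image_subset_iff.2 hΦmem)
  calc 2 * T''.card ≤ S.card := hS2
    _ ≤ 3 * (S.image Φ).card := hS3
    _ ≤ 3 * T'N.card := Nat.mul_le_mul_left 3 himg

end TwoThirds

end Summit.Ventures.Crystal3D.Theorems

end
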